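import Literature.NumberTheory.Automorphic.IwasawaDecompositionGL
import Literature.NumberTheory.Automorphic.JacquetModuleProofs
import HarnessLib

/-!
# Principal congruence subgroups, unipotent balls and the Iwahori factorisation for `GL_n(F)`

Topic `NumberTheory/Automorphic`, namespace `Literature.NumberTheory.Automorphic`. Let `F` be a field
with a `ValuativeRel` (valuation `v = valuation F`, valuation ring `𝒪 = 𝒪[F]`), later a
non-archimedean local field (`IsNonarchimedeanLocalField F`, Mathlib), `G = GL_n(F)`,
`K₀ = GL_n(𝒪) = glInt n F` (`ReductiveGroupData`) and `ϖ^a = zpowDiagGL hϖ a` the diagonal torus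
elements (`IwasawaDecompositionGL`). This file supplies the compact-open-subgroup technology used
in the proof of Harish-Chandra's criterion `isSupercuspidal_iff_jacquetGL`
(`ParabolicInductionSupercuspidalProofs`), all proved and Haar-measure free:

* `ValBound γ M` — every entry of the matrix `M` has valuation `≤ γ`; algebra of such bounds
  (ultrametric sums and products), integrality of determinant and adjugate
  (`valuation_det_le_one`, `valBound_one_adjugate`), and **inversion of matrices `≡ 1 mod 𝓂`**
  (`valuation_det_eq_one`, `isUnit_det_and_valBound_inv`: reduce modulo `𝓂`).
* `congruenceGL n γ ≤ GL_n(F)` — the **principal congruence subgroup of level `γ`** (`g` and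
  `g⁻¹` integral, `g - 1` and `g⁻¹ - 1` with entries of valuation `≤ γ`; for `γ = |ϖ^m|` this is
  `K_m = 1 + ϖ^m M_n(𝒪)`): open, compact, contained in `K₀`, and a **neighbourhood basis of `1`**
  (`exists_congruenceGL_subset`, by compactness: a directed family of compact closed sets with
  intersection `{1}`).
* conjugation by torus elements: `(ϖ^a g ϖ^{-a})_{ij} = ϖ^{a_i - a_j} g_{ij}`
  (`coe_zpowDiagGL_mul_mul_inv_apply` and variants).
* `mem_unipotentRadicalGL_iff_apply` — the unipotent radical `U_c` of a standard parabolic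
  (`ParabolicGL`) entrywise: `g_{ij} = δ_{ij}` whenever `c j ≤ c i`.
* `unipotentBallGL c γ` (for a **two-block** labelling `c : Fin n → Fin 2`) — the ball
  `{u ∈ U_c | all |(u - 1)_{ij}| ≤ γ}`, a subgroup because `(1 + X)(1 + Y) = 1 + X + Y` for `X, Y`
  strictly block-upper (`mul_eq_zero_of_blockUpper`); these balls are compact, closed, exhaust
  `U_c` (`exists_forall_mem_unipotentBallGL`), shrink to `1` (`exists_unipotentBallGL_subset`) and
  are moved by the torus: `ϖ^a (U_c ∩ B_γ) ϖ^{-a} ⊆ U_c ∩ B_δ` when `|ϖ|^{a_i - a_j} γ ≤ δ` across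
  the cut (`conj_mem_unipotentBallGL`).
* `oppositeParabolicGL F c = P_c⁻` (the standard parabolic of the reversed order) and the
  **Iwahori-type factorisation** `K_γ = (K_γ ∩ U_c)(K_γ ∩ P_c⁻)` for `γ < 1` and a two-block `c`
  (`exists_unipotent_mul_opposite_of_mem_congruenceGL`: block elimination
  `(A B; C D) = (1, B D⁻¹; 0, 1)(A - B D⁻¹ C, 0; C, D)` with `D ≡ 1 mod 𝓂` invertible over `𝒪`),
  and the stability `ϖ^{-a} (K_γ ∩ P_c⁻) ϖ^{a} ⊆ K_γ` for `a = N · 1_{c = 0}`, `N ≥ 0`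
  (`conj_mem_congruenceGL_of_mem_opposite`).

These are the standard facts "`K_m` is a basis of neighbourhoods of `1` consisting of compact open
subgroups with an Iwahori factorisation with respect to `(P, P⁻)`, and `a⁻¹ N₀⁻ a ⊆ N₀⁻`,
`a N₀ a⁻¹ ⊆ N₀` for dominant `a`" (Casselman 1995, §1.4, Prop. 1.4.3–1.4.4; Bernstein–Zelevinsky
1976, §3; Bushnell–Henniart 2006, §7–§8 for `GL(2)`), specialised to `GL_n` and two-block
parabolics, where they are elementary matrix algebra. No named facts, no `sorry`; the definitions
are `ValBound`, `congruenceGL`, `unipotentBallGL`, `blockUpperPart`, `unipotentOfMatrix`,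
`oppositeParabolicGL`.

## References

* W. Casselman, *Introduction to the theory of admissible representations of `p`-adic reductive
  groups*, unpublished notes (draft 1995), §1.4 (Prop. 1.4.3, Prop. 1.4.4).
* I. N. Bernstein, A. V. Zelevinsky, *Representations of the group `GL(n, F)` where `F` is a
  non-archimedean local field*, Russian Math. Surveys 31:3 (1976), 1–68, §3.
* C. J. Bushnell, G. Henniart, *The local Langlands conjecture for `GL(2)`*, Grundlehren 335
  (2006), §§7–8.
-/

noncomputable section

open scoped MatrixGroups Pointwise Topology
open ValuativeRel Matrix

namespace Literature.NumberTheory.Automorphic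

/-! ### Entrywise valuation bounds -/

section ValBound

variable {F : Type*} [Field F] [ValuativeRel F] {m : Type*} [Fintype m] [DecidableEq m]

/-- All entries of the matrix `M` have valuation `≤ γ`. [folklore] -/
def ValBound (γ : ValueGroupWithZero F) (M : Matrix m m F) : Prop :=
  ∀ i j, valuation F (M i j) ≤ γ

omit [Fintype m] [DecidableEq m] in
/-- Monotonicity of `ValBound` in the bound. [folklore] -/
theorem ValBound.mono {γ δ : ValueGroupWithZero F} {M : Matrix m m F} (h : ValBound γ M)
    (hγδ : γ ≤ δ) : ValBound δ M := fun i j => (h i j).trans hγδ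

omit [Fintype m] [DecidableEq m] in
/-- `ValBound` is stable under addition (ultrametric inequality). [folklore] -/
theorem ValBound.add {γ : ValueGroupWithZero F} {M N : Matrix m m F} (hM : ValBound γ M)
    (hN : ValBound γ N) : ValBound γ (M + N) := fun i j => by
  rw [Matrix.add_apply]
  exact Valuation.map_add_le _ (hM i j) (hN i j)

omit [Fintype m] [DecidableEq m] in
/-- `ValBound` is stable under negation. [folklore] -/
theorem ValBound.neg {γ : ValueGroupWithZero F} {M : Matrix m m F} (hM : ValBound γ M) :
    ValBound γ (-M) := fun i j => by
  rw [Matrix.neg_apply, Valuation.map_neg]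
  exact hM i j

omit [Fintype m] [DecidableEq m] in
/-- `ValBound` is stable under subtraction. [folklore] -/
theorem ValBound.sub {γ : ValueGroupWithZero F} {M N : Matrix m m F} (hM : ValBound γ M)
    (hN : ValBound γ N) : ValBound γ (M - N) := by
  rw [sub_eq_add_neg]; exact hM.add hN.neg

omit [Fintype m] [DecidableEq m] in
/-- The zero matrix satisfies every bound. [folklore] -/
theorem valBound_zero (γ : ValueGroupWithZero F) : ValBound γ (0 : Matrix m m F) := fun i j => by
  simp

omit [DecidableEq m] in
/-- Products: if the entries of `M` are `≤ α` and those of `N` are `≤ β` then the entries of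
`M N` are `≤ α β` (ultrametric inequality for the sum over the inner index). [folklore] -/
theorem ValBound.mul {α β : ValueGroupWithZero F} {M N : Matrix m m F} (hM : ValBound α M)
    (hN : ValBound β N) : ValBound (α * β) (M * N) := fun i j => by
  rw [Matrix.mul_apply]
  refine Valuation.map_sum_le _ fun l _ => ?_
  rw [map_mul]
  exact mul_le_mul' (hM i l) (hN l j)

omit [Fintype m] in
/-- The identity matrix has entries of valuation `≤ 1`. [folklore] -/
theorem valBound_one : ValBound 1 (1 : Matrix m m F) := fun i j => by
  rw [Matrix.one_apply]
  split_ifs <;> simp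

omit [Fintype m] in
/-- A matrix congruent to `1` within `γ ≤ 1` is integral. [folklore] -/
theorem ValBound.of_sub_one {γ : ValueGroupWithZero F} {M : Matrix m m F} (h : ValBound γ (M - 1))
    (hγ : γ ≤ 1) : ValBound 1 M := by
  have : M = (M - 1) + 1 := by abel
  rw [this]
  exact (h.mono hγ).add valBound_one

/-- If `M ≡ 1` and `N ≡ 1` within `γ`, and `N` is integral, then `M N ≡ 1` within `γ`:
`M N - 1 = (M - 1) N + (N - 1)`. [folklore] -/
theorem ValBound.mul_sub_one {γ : ValueGroupWithZero F} {M N : Matrix m m F}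
    (hM : ValBound γ (M - 1)) (hN : ValBound γ (N - 1)) (hN1 : ValBound 1 N) :
    ValBound γ (M * N - 1) := by
  have : M * N - 1 = (M - 1) * N + (N - 1) := by noncomm_ring
  rw [this]
  have h1 := hM.mul hN1
  rw [mul_one] at h1
  exact h1.add hN

end ValBound

/-! ### Principal congruence subgroups of `GL_n(F)` -/

section Congruence

variable {F : Type*} [Field F] [ValuativeRel F] (n : ℕ)

/-- The **principal congruence subgroup of level `γ`** of `GL_n(F)`: integral matrices with
integral inverse (`GL_n(𝒪)`) such that `g - 1` and `g⁻¹ - 1` have all entries of valuation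
`≤ γ`. For `γ = |ϖ^m|` this is `K_m = 1 + ϖ^m M_n(𝒪)`; for `γ ≥ 1` it is `GL_n(𝒪)`.
(Bernstein–Zelevinsky 1976, §3; Casselman 1995, §1.4.) [folklore] -/
def congruenceGL (γ : ValueGroupWithZero F) : Subgroup (GL (Fin n) F) where
  carrier := {g | (ValBound 1 (g : Matrix (Fin n) (Fin n) F) ∧
      ValBound 1 ((g⁻¹ : GL (Fin n) F) : Matrix (Fin n) (Fin n) F)) ∧
    ValBound γ ((g : Matrix (Fin n) (Fin n) F) - 1) ∧
      ValBound γ (((g⁻¹ : GL (Fin n) F) : Matrix (Fin n) (Fin n) F) - 1)}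
  mul_mem' {g h} hg hh := by
    refine ⟨⟨?_, ?_⟩, ?_, ?_⟩
    · rw [Units.val_mul]
      simpa using hg.1.1.mul hh.1.1
    · rw [_root_.mul_inv_rev, Units.val_mul]
      simpa using hh.1.2.mul hg.1.2
    · rw [Units.val_mul]
      exact hg.2.1.mul_sub_one hh.2.1 hh.1.1
    · rw [_root_.mul_inv_rev, Units.val_mul]
      exact hh.2.2.mul_sub_one hg.2.2 hg.1.2
  one_mem' := by
    refine ⟨⟨?_, ?_⟩, ?_, ?_⟩ <;> simp [valBound_one, valBound_zero]
  inv_mem' {g} hg := by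
    refine ⟨⟨hg.1.2, ?_⟩, hg.2.2, ?_⟩ <;> rw [inv_inv]
    exacts [hg.1.1, hg.2.1]

variable {n}

/-- Membership in the principal congruence subgroup. [folklore] -/
theorem mem_congruenceGL_iff {γ : ValueGroupWithZero F} {g : GL (Fin n) F} :
    g ∈ congruenceGL n γ ↔ (ValBound 1 (g : Matrix (Fin n) (Fin n) F) ∧
      ValBound 1 ((g⁻¹ : GL (Fin n) F) : Matrix (Fin n) (Fin n) F)) ∧
    ValBound γ ((g : Matrix (Fin n) (Fin n) F) - 1) ∧
      ValBound γ (((g⁻¹ : GL (Fin n) F) : Matrix (Fin n) (Fin n) F) - 1) :=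
  Iff.rfl

/-- Principal congruence subgroups are contained in `GL_n(𝒪)`. [folklore] -/
theorem congruenceGL_le_glInt (γ : ValueGroupWithZero F) : congruenceGL n γ ≤ glInt n F := by
  intro g hg
  rw [mem_glInt_iff]
  exact ⟨fun i j => (Valuation.mem_integer_iff _ _).2 (hg.1.1 i j),
    fun i j => (Valuation.mem_integer_iff _ _).2 (hg.1.2 i j)⟩

/-- The family of principal congruence subgroups is monotone in the level. [folklore] -/
theorem congruenceGL_mono {γ δ : ValueGroupWithZero F} (h : γ ≤ δ) :
    congruenceGL n γ ≤ congruenceGL n δ := fun _ hg =>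
  ⟨hg.1, hg.2.1.mono h, hg.2.2.mono h⟩

end Congruence

/-! ### Closed balls of the valuation are closed (openness: `DeltaCharBorel.isOpen_setOf_valuation_le`,
`JacquetModuleProofs`) -/

section Balls

variable {F : Type*} [Field F] [ValuativeRel F] [TopologicalSpace F] [IsValuativeTopology F]

/-- A closed ball `{x | |x| ≤ γ}` is closed. [folklore] -/
theorem isClosed_setOf_valuation_le (γ : ValueGroupWithZero F) :
    IsClosed {x : F | valuation F x ≤ γ} := by
  rw [← isOpen_compl_iff]
  refine isOpen_iff_mem_nhds.2 fun x hx => ?_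
  simp only [Set.mem_compl_iff, Set.mem_setOf_eq, not_le] at hx
  refine (IsValuativeTopology.mem_nhds_iff').2 ⟨Units.mk0 (valuation F x) hx.ne_bot, fun z hz => ?_⟩
  simp only [Set.mem_compl_iff, Set.mem_setOf_eq, not_le]
  rwa [Valuation.map_eq_of_sub_lt _ hz]

omit [TopologicalSpace F] [IsValuativeTopology F] in
/-- Only `0` has valuation below every unit of the value group (the valuation is non-trivial).
[folklore] -/
theorem eq_zero_of_forall_valuation_le [(ValuativeRel.IsNontrivial F)] {y : F}
    (h : ∀ γ : (ValueGroupWithZero F)ˣ, valuation F y ≤ γ) : y = 0 := by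
  by_contra hy
  have hvy : valuation F y ≠ 0 := by simpa using hy
  obtain ⟨z, hz0, hz1⟩ := Valuation.IsNontrivial.exists_lt_one (v := valuation F)
  have hγ : valuation F z * valuation F y ≠ 0 := mul_ne_zero ((Valuation.ne_zero_iff _).2 hz0) hvy
  have := h (Units.mk0 _ hγ)
  rw [Units.val_mk0] at this
  have hlt : valuation F z * valuation F y < valuation F y :=
    mul_lt_of_lt_one_left (lt_of_le_of_ne zero_le hvy.symm) hz1
  exact absurd this (not_le.2 hlt)

end Balls

/-! ### Topology of the principal congruence subgroups -/

section CongruenceTopology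

variable {F : Type*} [Field F] [ValuativeRel F] [TopologicalSpace F] [IsNonarchimedeanLocalField F]
  {n : ℕ}

/-- A set of invertible matrices cut out by an entrywise valuation bound on a continuous
matrix-valued function is open (non-zero bound). [folklore] -/
theorem isOpen_setOf_valBound {f : GL (Fin n) F → Matrix (Fin n) (Fin n) F} (hf : Continuous f)
    {γ : ValueGroupWithZero F} (hγ : γ ≠ 0) : IsOpen {g : GL (Fin n) F | ValBound γ (f g)} := by
  have : {g : GL (Fin n) F | ValBound γ (f g)} =
      ⋂ i, ⋂ j, (fun g => f g i j) ⁻¹' {x : F | valuation F x ≤ γ} := by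
    ext g; simp [ValBound]
  rw [this]
  exact isOpen_iInter_of_finite fun i => isOpen_iInter_of_finite fun j =>
    (DeltaCharBorel.isOpen_setOf_valuation_le hγ).preimage (hf.matrix_elem i j)

/-- A set of invertible matrices cut out by an entrywise valuation bound on a continuous
matrix-valued function is closed. [folklore] -/
theorem isClosed_setOf_valBound {f : GL (Fin n) F → Matrix (Fin n) (Fin n) F} (hf : Continuous f)
    (γ : ValueGroupWithZero F) : IsClosed {g : GL (Fin n) F | ValBound γ (f g)} := by
  have : {g : GL (Fin n) F | ValBound γ (f g)} =
      ⋂ i, ⋂ j, (fun g => f g i j) ⁻¹' {x : F | valuation F x ≤ γ} := by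
    ext g; simp [ValBound]
  rw [this]
  exact isClosed_iInter fun i => isClosed_iInter fun j =>
    (isClosed_setOf_valuation_le γ).preimage (hf.matrix_elem i j)

/-- `g ↦ g - 1` is continuous on `GL_n(F)` (matrix values). [folklore] -/
theorem continuous_val_sub_one :
    Continuous fun g : GL (Fin n) F => (g : Matrix (Fin n) (Fin n) F) - 1 :=
  Units.continuous_val.sub continuous_const

/-- `g ↦ g⁻¹ - 1` is continuous on `GL_n(F)` (matrix values). [folklore] -/
theorem continuous_inv_sub_one :
    Continuous fun g : GL (Fin n) F => ((g⁻¹ : GL (Fin n) F) : Matrix (Fin n) (Fin n) F) - 1 :=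
  Units.continuous_coe_inv.sub continuous_const

omit [TopologicalSpace F] [IsNonarchimedeanLocalField F] in
/-- The carrier of `congruenceGL n γ` as an intersection of four entrywise conditions. [folklore] -/
theorem coe_congruenceGL (γ : ValueGroupWithZero F) :
    (congruenceGL n γ : Set (GL (Fin n) F)) =
      ({g : GL (Fin n) F | ValBound 1 (g : Matrix (Fin n) (Fin n) F)} ∩
        {g : GL (Fin n) F | ValBound 1 ((g⁻¹ : GL (Fin n) F) : Matrix (Fin n) (Fin n) F)}) ∩
      ({g : GL (Fin n) F | ValBound γ ((g : Matrix (Fin n) (Fin n) F) - 1)} ∩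
        {g : GL (Fin n) F | ValBound γ (((g⁻¹ : GL (Fin n) F) : Matrix (Fin n) (Fin n) F) - 1)}) := by
  ext g; simp only [SetLike.mem_coe, mem_congruenceGL_iff, Set.mem_inter_iff, Set.mem_setOf_eq]

/-- Principal congruence subgroups of non-zero level are open. [folklore] -/
theorem isOpen_congruenceGL {γ : ValueGroupWithZero F} (hγ : γ ≠ 0) :
    IsOpen (congruenceGL n γ : Set (GL (Fin n) F)) := by
  rw [coe_congruenceGL]
  exact ((isOpen_setOf_valBound Units.continuous_val one_ne_zero).inter
    (isOpen_setOf_valBound Units.continuous_coe_inv one_ne_zero)).inter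
    ((isOpen_setOf_valBound continuous_val_sub_one hγ).inter
      (isOpen_setOf_valBound continuous_inv_sub_one hγ))

/-- Principal congruence subgroups are closed. [folklore] -/
theorem isClosed_congruenceGL (γ : ValueGroupWithZero F) :
    IsClosed (congruenceGL n γ : Set (GL (Fin n) F)) := by
  rw [coe_congruenceGL]
  exact ((isClosed_setOf_valBound Units.continuous_val 1).inter
    (isClosed_setOf_valBound Units.continuous_coe_inv 1)).inter
    ((isClosed_setOf_valBound continuous_val_sub_one γ).inter
      (isClosed_setOf_valBound continuous_inv_sub_one γ))

/-- Principal congruence subgroups are compact (closed in the compact `GL_n(𝒪)`). [folklore] -/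
theorem isCompact_congruenceGL (γ : ValueGroupWithZero F) :
    IsCompact (congruenceGL n γ : Set (GL (Fin n) F)) :=
  (isCompact_glInt n F).of_isClosed_subset (isClosed_congruenceGL (n := n) γ)
    (congruenceGL_le_glInt (n := n) γ)

/-- Only `1` lies in every principal congruence subgroup. [folklore] -/
theorem eq_one_of_forall_mem_congruenceGL {g : GL (Fin n) F}
    (h : ∀ γ : (ValueGroupWithZero F)ˣ, g ∈ congruenceGL n (γ : ValueGroupWithZero F)) : g = 1 := by
  refine Units.ext (Matrix.ext fun i j => ?_)
  have h0 : ((g : Matrix (Fin n) (Fin n) F) - 1) i j = 0 :=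
    eq_zero_of_forall_valuation_le fun γ => (h γ).2.1 i j
  rwa [Matrix.sub_apply, sub_eq_zero] at h0

/-- **The principal congruence subgroups form a neighbourhood basis of `1`**: every
neighbourhood of `1` in `GL_n(F)` contains some `congruenceGL n γ`, `γ ≠ 0`. (Compactness: the
`congruenceGL n γ` are a directed family of compact closed sets with intersection `{1}`.)
(Bernstein–Zelevinsky 1976, §1; Casselman 1995, Prop. 1.4.4.) [folklore] -/
theorem exists_congruenceGL_subset {U : Set (GL (Fin n) F)} (hU : U ∈ 𝓝 (1 : GL (Fin n) F)) :
    ∃ γ : (ValueGroupWithZero F)ˣ,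
      (congruenceGL n (γ : ValueGroupWithZero F) : Set (GL (Fin n) F)) ⊆ U := by
  have hdir : Directed (· ⊇ ·) fun γ : (ValueGroupWithZero F)ˣ =>
      (congruenceGL n (γ : ValueGroupWithZero F) : Set (GL (Fin n) F)) := by
    intro γ₁ γ₂
    rcases le_total γ₁ γ₂ with h | h
    · exact ⟨γ₁, subset_rfl, congruenceGL_mono (Units.val_le_val.2 h)⟩
    · exact ⟨γ₂, congruenceGL_mono (Units.val_le_val.2 h), subset_rfl⟩
  have hcpt : ∀ γ : (ValueGroupWithZero F)ˣ,
      IsCompact (congruenceGL n (γ : ValueGroupWithZero F) : Set (GL (Fin n) F)) :=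
    fun γ => isCompact_congruenceGL _
  have hcl : ∀ γ : (ValueGroupWithZero F)ˣ,
      IsClosed (congruenceGL n (γ : ValueGroupWithZero F) : Set (GL (Fin n) F)) :=
    fun γ => isClosed_congruenceGL _
  have hU' : ∀ x ∈ ⋂ γ : (ValueGroupWithZero F)ˣ,
      (congruenceGL n (γ : ValueGroupWithZero F) : Set (GL (Fin n) F)), U ∈ 𝓝 x := by
    intro x hx
    obtain rfl : x = 1 := eq_one_of_forall_mem_congruenceGL fun γ => Set.mem_iInter.1 hx γ
    exact hU
  exact exists_subset_nhds_of_isCompact' hdir hcpt hcl hU'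

end CongruenceTopology

/-! ### Conjugation by torus elements -/

section Torus

variable {F : Type*} [Field F] {n : ℕ} {ϖ : F} (hϖ : ϖ ≠ 0)

/-- Entries of `ϖ^a g ϖ^{-a}`: `(ϖ^a g ϖ^{-a})_{ij} = ϖ^{a_i - a_j} g_{ij}`. [folklore] -/
theorem coe_zpowDiagGL_mul_mul_inv_apply (a : Fin n → ℤ) (g : GL (Fin n) F) (i j : Fin n) :
    ((zpowDiagGL hϖ a * g * (zpowDiagGL hϖ a)⁻¹ : GL (Fin n) F) : Matrix (Fin n) (Fin n) F) i j =
      ϖ ^ (a i - a j) * (g : Matrix (Fin n) (Fin n) F) i j := by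
  rw [← zpowDiagGL_neg, Units.val_mul, Units.val_mul, coe_zpowDiagGL, coe_zpowDiagGL,
    Matrix.mul_diagonal, Matrix.diagonal_mul, Pi.neg_apply, zpow_sub₀ hϖ, _root_.zpow_neg]
  ring

/-- Entries of `ϖ^{-a} g ϖ^{a}`: `(ϖ^{-a} g ϖ^{a})_{ij} = ϖ^{a_j - a_i} g_{ij}`. [folklore] -/
theorem coe_zpowDiagGL_inv_mul_mul_apply (a : Fin n → ℤ) (g : GL (Fin n) F) (i j : Fin n) :
    (((zpowDiagGL hϖ a)⁻¹ * g * zpowDiagGL hϖ a : GL (Fin n) F) : Matrix (Fin n) (Fin n) F) i j =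
      ϖ ^ (a j - a i) * (g : Matrix (Fin n) (Fin n) F) i j := by
  have := coe_zpowDiagGL_mul_mul_inv_apply hϖ (-a) g i j
  rwa [zpowDiagGL_neg, inv_inv, Pi.neg_apply, Pi.neg_apply, neg_sub_neg] at this

/-- Conjugation commutes with subtracting `1`: `t g t⁻¹ - 1 = t (g - 1) t⁻¹` entrywise, i.e.
`(t g t⁻¹ - 1)_{ij} = ϖ^{a_i - a_j} (g - 1)_{ij}`. [folklore] -/
theorem coe_zpowDiagGL_mul_mul_inv_sub_one_apply (a : Fin n → ℤ) (g : GL (Fin n) F) (i j : Fin n) :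
    (((zpowDiagGL hϖ a * g * (zpowDiagGL hϖ a)⁻¹ : GL (Fin n) F) : Matrix (Fin n) (Fin n) F) - 1) i j =
      ϖ ^ (a i - a j) * ((g : Matrix (Fin n) (Fin n) F) - 1) i j := by
  rw [Matrix.sub_apply, coe_zpowDiagGL_mul_mul_inv_apply, Matrix.sub_apply, mul_sub]
  congr 1
  rcases eq_or_ne i j with rfl | h
  · simp
  · simp [Matrix.one_apply_ne h]

/-- Same for `ϖ^{-a} g ϖ^{a}`. [folklore] -/
theorem coe_zpowDiagGL_inv_mul_mul_sub_one_apply (a : Fin n → ℤ) (g : GL (Fin n) F) (i j : Fin n) :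
    ((((zpowDiagGL hϖ a)⁻¹ * g * zpowDiagGL hϖ a : GL (Fin n) F) : Matrix (Fin n) (Fin n) F) - 1) i j =
      ϖ ^ (a j - a i) * ((g : Matrix (Fin n) (Fin n) F) - 1) i j := by
  have := coe_zpowDiagGL_mul_mul_inv_sub_one_apply hϖ (-a) g i j
  rwa [zpowDiagGL_neg, inv_inv, Pi.neg_apply, Pi.neg_apply, neg_sub_neg] at this

end Torus

/-! ### Unipotent radicals of standard parabolics: entrywise description -/

section Unipotent

variable {R : Type*} [CommRing R] {n : Type*} [Fintype n] [DecidableEq n] {α : Type*} [LinearOrder α]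
  {c : n → α}

/-- **Entrywise description of `U_c`**: `g ∈ U_c` iff `g_{ij} = δ_{ij}` whenever `c j ≤ c i`, i.e.
`g - 1` is supported on the positions `(i, j)` with `c i < c j` (strictly above the block
diagonal). (Bernstein–Zelevinsky 1977, §2.1.) [folklore] -/
theorem mem_unipotentRadicalGL_iff_apply (g : GL n R) :
    g ∈ unipotentRadicalGL R c ↔
      ∀ i j, c j ≤ c i → (g : Matrix n n R) i j = (1 : Matrix n n R) i j := by
  rw [mem_unipotentRadicalGL_iff]
  constructor
  · rintro ⟨hT, h1⟩ i j hij
    rcases hij.lt_or_eq with hlt | heq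
    · rw [hT hlt, Matrix.one_apply_ne]
      rintro rfl
      exact lt_irrefl _ hlt
    · have := congrFun (congrFun (h1 (c i)) ⟨i, rfl⟩) ⟨j, heq⟩
      simp only [Matrix.toSquareBlock_def, Matrix.of_apply, Matrix.one_apply,
        Subtype.mk.injEq] at this
      rw [this, Matrix.one_apply]
  · intro h
    refine ⟨fun i j hlt => ?_, fun a => ?_⟩
    · rw [h i j hlt.le, Matrix.one_apply_ne]
      rintro rfl
      exact lt_irrefl _ hlt
    · ext ⟨i, hi⟩ ⟨j, hj⟩
      simp only [Matrix.toSquareBlock_def, Matrix.of_apply, Matrix.one_apply, Subtype.mk.injEq]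
      rw [h i j (by rw [hi, hj]), Matrix.one_apply]

/-- For `u ∈ U_c` the matrix `u - 1` vanishes at the positions `(i, j)` with `c j ≤ c i`. [folklore] -/
theorem sub_one_apply_eq_zero_of_mem_unipotentRadicalGL {g : GL n R} (hg : g ∈ unipotentRadicalGL R c)
    {i j : n} (hij : c j ≤ c i) : ((g : Matrix n n R) - 1) i j = 0 := by
  rw [Matrix.sub_apply, (mem_unipotentRadicalGL_iff_apply g).1 hg i j hij, sub_self]

end Unipotent

/-! ### Two-block labellings: unipotent balls -/

section TwoBlock

variable {F : Type*} [Field F] {n : ℕ} {c : Fin n → Fin 2}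

/-- In `Fin 2` there is no chain `x < y < z`. [folklore] -/
theorem fin_two_not_lt_of_lt {x y z : Fin 2} (h₁ : x < y) (h₂ : y < z) : False := by
  revert x y z h₁ h₂; decide

/-- **Two-block unipotent radicals are abelian with square-zero Lie algebra**: two matrices
supported strictly above the block diagonal of a labelling with two blocks multiply to `0`.
[folklore] -/
theorem mul_eq_zero_of_blockUpper {X Y : Matrix (Fin n) (Fin n) F}
    (hX : ∀ i j, c j ≤ c i → X i j = 0) (hY : ∀ i j, c j ≤ c i → Y i j = 0) : X * Y = 0 := by
  ext i j
  rw [Matrix.mul_apply, Matrix.zero_apply]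
  refine Finset.sum_eq_zero fun l _ => ?_
  by_cases h1 : c l ≤ c i
  · rw [hX i l h1, zero_mul]
  · by_cases h2 : c j ≤ c l
    · rw [hY l j h2, mul_zero]
    · exact (fin_two_not_lt_of_lt (not_le.1 h1) (not_le.1 h2)).elim

/-- For `g ∈ GL_n` with `g_{ij} = δ_{ij}` whenever `c j ≤ c i`, the matrix `g - 1` is supported
strictly above the block diagonal. [folklore] -/
theorem sub_one_apply_eq_zero_of_shape {g : Matrix (Fin n) (Fin n) F}
    (hg : ∀ i j, c j ≤ c i → g i j = (1 : Matrix (Fin n) (Fin n) F) i j) {i j : Fin n}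
    (hij : c j ≤ c i) : (g - 1) i j = 0 := by
  rw [Matrix.sub_apply, hg i j hij, sub_self]

variable [ValuativeRel F]

variable (c) in
/-- The **ball of radius `γ` in the unipotent radical** `U_c` of a two-block standard parabolic
of `GL_n(F)`: the elements `u ∈ U_c` all of whose entries `(u - 1)_{ij}` have valuation `≤ γ`.
For `γ = |ϖ^r|` these are the compact open subgroups `U_c ∩ ϖ^{r} M_n(𝒪)`-style pieces
exhausting `U_c` (`r → -∞`) and shrinking to `1` (`r → +∞`); they are subgroups because
`(1 + X)(1 + Y) = 1 + X + Y` for `X, Y` strictly block-upper with two blocks.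
(Bernstein–Zelevinsky 1976, §3; Casselman 1995, proof of Prop. 1.4.4.) [folklore] -/
def unipotentBallGL (γ : ValueGroupWithZero F) : Subgroup (GL (Fin n) F) where
  carrier := {g | (∀ i j, c j ≤ c i →
      (g : Matrix (Fin n) (Fin n) F) i j = (1 : Matrix (Fin n) (Fin n) F) i j) ∧
    ValBound γ ((g : Matrix (Fin n) (Fin n) F) - 1)}
  mul_mem' {g h} hg hh := by
    have hXY : ((g : Matrix (Fin n) (Fin n) F) - 1) * ((h : Matrix (Fin n) (Fin n) F) - 1) = 0 :=
      mul_eq_zero_of_blockUpper (fun i j hij => sub_one_apply_eq_zero_of_shape hg.1 hij)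
        (fun i j hij => sub_one_apply_eq_zero_of_shape hh.1 hij)
    have hgh : (g : Matrix (Fin n) (Fin n) F) * h - 1 =
        ((g : Matrix (Fin n) (Fin n) F) - 1) + ((h : Matrix (Fin n) (Fin n) F) - 1) := by
      have : (g : Matrix (Fin n) (Fin n) F) * h - 1 =
          ((g : Matrix (Fin n) (Fin n) F) - 1) + ((h : Matrix (Fin n) (Fin n) F) - 1) +
            ((g : Matrix (Fin n) (Fin n) F) - 1) * ((h : Matrix (Fin n) (Fin n) F) - 1) := by
        noncomm_ring
      rw [this, hXY, add_zero]
    refine ⟨fun i j hij => ?_, ?_⟩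
    · have : ((g * h : GL (Fin n) F) : Matrix (Fin n) (Fin n) F) i j =
          ((g : Matrix (Fin n) (Fin n) F) * h - 1) i j + (1 : Matrix (Fin n) (Fin n) F) i j := by
        rw [Units.val_mul, Matrix.sub_apply, sub_add_cancel]
      rw [this, hgh, Matrix.add_apply, sub_one_apply_eq_zero_of_shape hg.1 hij,
        sub_one_apply_eq_zero_of_shape hh.1 hij, add_zero, zero_add]
    · rw [Units.val_mul, hgh]
      exact hg.2.add hh.2
  one_mem' := ⟨fun i j _ => rfl, by simpa using valBound_zero γ⟩
  inv_mem' {g} hg := by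
    have hXX : ((g : Matrix (Fin n) (Fin n) F) - 1) * ((g : Matrix (Fin n) (Fin n) F) - 1) = 0 :=
      mul_eq_zero_of_blockUpper (fun i j hij => sub_one_apply_eq_zero_of_shape hg.1 hij)
        (fun i j hij => sub_one_apply_eq_zero_of_shape hg.1 hij)
    have hinv : ((g⁻¹ : GL (Fin n) F) : Matrix (Fin n) (Fin n) F) =
        1 - ((g : Matrix (Fin n) (Fin n) F) - 1) := by
      refine Units.inv_eq_of_mul_eq_one_right ?_
      have : (g : Matrix (Fin n) (Fin n) F) * (1 - ((g : Matrix (Fin n) (Fin n) F) - 1)) =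
          1 - ((g : Matrix (Fin n) (Fin n) F) - 1) * ((g : Matrix (Fin n) (Fin n) F) - 1) := by
        noncomm_ring
      rw [this, hXX, sub_zero]
    refine ⟨fun i j hij => ?_, ?_⟩
    · rw [hinv, Matrix.sub_apply, sub_one_apply_eq_zero_of_shape hg.1 hij, sub_zero]
    · rw [hinv, sub_sub_cancel_left]
      exact hg.2.neg

/-- Membership in a unipotent ball. [folklore] -/
theorem mem_unipotentBallGL_iff {γ : ValueGroupWithZero F} {g : GL (Fin n) F} :
    g ∈ unipotentBallGL c γ ↔ (∀ i j, c j ≤ c i →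
      (g : Matrix (Fin n) (Fin n) F) i j = (1 : Matrix (Fin n) (Fin n) F) i j) ∧
    ValBound γ ((g : Matrix (Fin n) (Fin n) F) - 1) :=
  Iff.rfl

/-- Unipotent balls lie in the unipotent radical `U_c`. [folklore] -/
theorem unipotentBallGL_le (γ : ValueGroupWithZero F) :
    unipotentBallGL c γ ≤ unipotentRadicalGL F c := fun g hg =>
  (mem_unipotentRadicalGL_iff_apply g).2 hg.1

/-- Unipotent balls grow with the radius. [folklore] -/
theorem unipotentBallGL_mono {γ δ : ValueGroupWithZero F} (h : γ ≤ δ) :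
    unipotentBallGL c γ ≤ unipotentBallGL c δ := fun _ hg => ⟨hg.1, hg.2.mono h⟩

/-- **The unipotent balls exhaust `U_c`**: every finite family of elements of `U_c` lies in a
common ball. [folklore] -/
theorem exists_forall_mem_unipotentBallGL {ι : Type*} [Finite ι] (u : ι → GL (Fin n) F)
    (hu : ∀ k, u k ∈ unipotentRadicalGL F c) :
    ∃ γ : ValueGroupWithZero F, ∀ k, u k ∈ unipotentBallGL c γ := by
  classical
  haveI := Fintype.ofFinite ι
  refine ⟨Finset.univ.sup fun p : ι × Fin n × Fin n =>
    valuation F ((((u p.1 : GL (Fin n) F) : Matrix (Fin n) (Fin n) F) - 1) p.2.1 p.2.2),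
    fun k => ⟨(mem_unipotentRadicalGL_iff_apply _).1 (hu k), fun i j => ?_⟩⟩
  exact Finset.le_sup (f := fun p : ι × Fin n × Fin n =>
    valuation F ((((u p.1 : GL (Fin n) F) : Matrix (Fin n) (Fin n) F) - 1) p.2.1 p.2.2))
    (Finset.mem_univ (k, i, j))

/-- **Conjugating a unipotent ball by a torus element**: if `|ϖ|^{a_i - a_j} γ ≤ δ` for all
positions `(i, j)` strictly above the block diagonal, then `ϖ^a (U_c ∩ B_γ) ϖ^{-a} ⊆ U_c ∩ B_δ`
(the entry `(i, j)` is multiplied by `ϖ^{a_i - a_j}`). (Casselman 1995, Prop. 1.4.3.) [folklore] -/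
theorem conj_mem_unipotentBallGL {ϖ : F} (hϖ : ϖ ≠ 0) {a : Fin n → ℤ} {γ δ : ValueGroupWithZero F}
    (h : ∀ i j, c i < c j → valuation F ϖ ^ (a i - a j) * γ ≤ δ) {u : GL (Fin n) F}
    (hu : u ∈ unipotentBallGL c γ) :
    zpowDiagGL hϖ a * u * (zpowDiagGL hϖ a)⁻¹ ∈ unipotentBallGL c δ := by
  refine ⟨fun i j hij => ?_, fun i j => ?_⟩
  · rw [coe_zpowDiagGL_mul_mul_inv_apply, hu.1 i j hij]
    rcases eq_or_ne i j with rfl | hne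
    · simp
    · simp [Matrix.one_apply_ne hne]
  · rw [coe_zpowDiagGL_mul_mul_inv_sub_one_apply, map_mul, map_zpow₀]
    by_cases hij : c j ≤ c i
    · rw [sub_one_apply_eq_zero_of_shape hu.1 hij, map_zero, mul_zero]
      exact zero_le
    · exact (mul_le_mul' le_rfl (hu.2 i j)).trans (h i j (not_le.1 hij))

end TwoBlock

/-! ### Topology of the unipotent balls -/

section TwoBlockTopology

variable {F : Type*} [Field F] {n : ℕ} (c : Fin n → Fin 2)

/-- The strictly block-upper part of a matrix (entries at positions `c i < c j`). [folklore] -/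
def blockUpperPart (X : Matrix (Fin n) (Fin n) F) : Matrix (Fin n) (Fin n) F :=
  Matrix.of fun i j => if c i < c j then X i j else 0

variable {c}

/-- The strictly block-upper part vanishes on and below the block diagonal. [folklore] -/
theorem blockUpperPart_apply_of_le (X : Matrix (Fin n) (Fin n) F) {i j : Fin n} (h : c j ≤ c i) :
    blockUpperPart c X i j = 0 := by
  simp [blockUpperPart, not_lt.2 h]

/-- Above the block diagonal the strictly block-upper part of `X` agrees with `X`. [folklore] -/
theorem blockUpperPart_apply_of_lt (X : Matrix (Fin n) (Fin n) F) {i j : Fin n} (h : c i < c j) :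
    blockUpperPart c X i j = X i j := by
  simp [blockUpperPart, h]

variable (c)

/-- The unipotent element `1 + X⁺` of `GL_n(F)` attached to a matrix `X` (`X⁺` its strictly
block-upper part), with inverse `1 - X⁺` since `(X⁺)² = 0`. [folklore] -/
def unipotentOfMatrix (X : Matrix (Fin n) (Fin n) F) : GL (Fin n) F where
  val := 1 + blockUpperPart c X
  inv := 1 - blockUpperPart c X
  val_inv := by
    have h0 : blockUpperPart c X * blockUpperPart c X = 0 :=
      mul_eq_zero_of_blockUpper (fun i j h => blockUpperPart_apply_of_le X h)
        (fun i j h => blockUpperPart_apply_of_le X h)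
    have : (1 + blockUpperPart c X) * (1 - blockUpperPart c X) =
        1 - blockUpperPart c X * blockUpperPart c X := by noncomm_ring
    rw [this, h0, sub_zero]
  inv_val := by
    have h0 : blockUpperPart c X * blockUpperPart c X = 0 :=
      mul_eq_zero_of_blockUpper (fun i j h => blockUpperPart_apply_of_le X h)
        (fun i j h => blockUpperPart_apply_of_le X h)
    have : (1 - blockUpperPart c X) * (1 + blockUpperPart c X) =
        1 - blockUpperPart c X * blockUpperPart c X := by noncomm_ring
    rw [this, h0, sub_zero]

/-- The matrix of `unipotentOfMatrix c X` is `1 + X⁺`. [folklore] -/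
@[simp] theorem coe_unipotentOfMatrix (X : Matrix (Fin n) (Fin n) F) :
    ((unipotentOfMatrix c X : GL (Fin n) F) : Matrix (Fin n) (Fin n) F) = 1 + blockUpperPart c X :=
  rfl

/-- The matrix of `(unipotentOfMatrix c X)⁻¹` is `1 - X⁺`. [folklore] -/
@[simp] theorem coe_unipotentOfMatrix_inv (X : Matrix (Fin n) (Fin n) F) :
    (((unipotentOfMatrix c X)⁻¹ : GL (Fin n) F) : Matrix (Fin n) (Fin n) F) =
      1 - blockUpperPart c X :=
  rfl

variable [ValuativeRel F]

variable {c} in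
/-- Every element of a unipotent ball is `unipotentOfMatrix c X` for `X = u - 1`, whose
entries are bounded by the radius. [folklore] -/
theorem unipotentBallGL_subset_image (γ : ValueGroupWithZero F) :
    (unipotentBallGL c γ : Set (GL (Fin n) F)) ⊆
      unipotentOfMatrix c '' {X : Matrix (Fin n) (Fin n) F | ValBound γ X} := by
  intro g hg
  refine ⟨(g : Matrix (Fin n) (Fin n) F) - 1, hg.2, Units.ext (Matrix.ext fun i j => ?_)⟩
  rw [coe_unipotentOfMatrix, Matrix.add_apply]
  by_cases h : c i < c j
  · rw [blockUpperPart_apply_of_lt _ h, Matrix.sub_apply, add_sub_cancel]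
  · rw [blockUpperPart_apply_of_le _ (not_lt.1 h), add_zero, hg.1 i j (not_lt.1 h)]

variable [TopologicalSpace F]

omit [ValuativeRel F] in
/-- `X ↦ 1 + X⁺` is continuous into `GL_n(F)` (both `1 ± X⁺` are continuous in `X`). [folklore] -/
theorem continuous_unipotentOfMatrix [IsTopologicalRing F] :
    Continuous (unipotentOfMatrix c : Matrix (Fin n) (Fin n) F → GL (Fin n) F) := by
  have hB : Continuous (blockUpperPart c : Matrix (Fin n) (Fin n) F → Matrix (Fin n) (Fin n) F) := by
    refine continuous_matrix fun i j => ?_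
    by_cases h : c i < c j
    · simp only [blockUpperPart_apply_of_lt _ h]
      exact continuous_id.matrix_elem i j
    · simp only [blockUpperPart_apply_of_le _ (not_lt.1 h)]
      exact continuous_const
  refine Units.continuous_iff.2 ⟨?_, ?_⟩
  · exact continuous_const.add hB
  · exact continuous_const.sub hB

variable [IsNonarchimedeanLocalField F]

/-- The box `{X | all |X_{ij}| ≤ γ}` of matrices is compact (`𝒪`-balls are compact in a local
field). [folklore] -/
theorem isCompact_setOf_valBound (γ : ValueGroupWithZero F) :
    IsCompact {X : Matrix (Fin n) (Fin n) F | ValBound γ X} := by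
  have : {X : Matrix (Fin n) (Fin n) F | ValBound γ X} =
      Set.univ.pi fun _ : Fin n => Set.univ.pi fun _ : Fin n => {x : F | valuation F x ≤ γ} := by
    ext X
    exact ⟨fun h i _ j _ => h i j, fun h i j => h i trivial j trivial⟩
  rw [this]
  exact isCompact_univ_pi fun _ => isCompact_univ_pi fun _ =>
    IsNonarchimedeanLocalField.isCompact_closedBall F γ

variable {c}

/-- Unipotent balls are closed. [folklore] -/
theorem isClosed_unipotentBallGL (γ : ValueGroupWithZero F) :
    IsClosed (unipotentBallGL c γ : Set (GL (Fin n) F)) := by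
  haveI := (GaloisRepresentations.IsNonarchimedeanLocalField.isLocalField F).toT2Space
  have : (unipotentBallGL c γ : Set (GL (Fin n) F)) =
      (⋂ i, ⋂ j, {g : GL (Fin n) F | c j ≤ c i →
        (g : Matrix (Fin n) (Fin n) F) i j = (1 : Matrix (Fin n) (Fin n) F) i j}) ∩
      {g : GL (Fin n) F | ValBound γ ((g : Matrix (Fin n) (Fin n) F) - 1)} := by
    ext g
    simp only [SetLike.mem_coe, mem_unipotentBallGL_iff, Set.mem_inter_iff, Set.mem_iInter,
      Set.mem_setOf_eq]
  rw [this]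
  refine IsClosed.inter (isClosed_iInter fun i => isClosed_iInter fun j => ?_)
    (isClosed_setOf_valBound continuous_val_sub_one γ)
  by_cases hij : c j ≤ c i
  · simp only [hij, forall_const]
    exact isClosed_eq (Units.continuous_val.matrix_elem i j) continuous_const
  · simp [hij]

/-- Unipotent balls are compact: closed subsets of the continuous image of a compact box.
[folklore] -/
theorem isCompact_unipotentBallGL (γ : ValueGroupWithZero F) :
    IsCompact (unipotentBallGL c γ : Set (GL (Fin n) F)) :=
  ((isCompact_setOf_valBound γ).image (continuous_unipotentOfMatrix c)).of_isClosed_subset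
    (isClosed_unipotentBallGL γ) (unipotentBallGL_subset_image γ)

/-- Only `1` lies in every unipotent ball. [folklore] -/
theorem eq_one_of_forall_mem_unipotentBallGL {g : GL (Fin n) F}
    (h : ∀ γ : (ValueGroupWithZero F)ˣ, g ∈ unipotentBallGL c (γ : ValueGroupWithZero F)) :
    g = 1 := by
  refine Units.ext (Matrix.ext fun i j => ?_)
  have h0 : ((g : Matrix (Fin n) (Fin n) F) - 1) i j = 0 :=
    eq_zero_of_forall_valuation_le fun γ => (h γ).2 i j
  rwa [Matrix.sub_apply, sub_eq_zero] at h0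

/-- **The unipotent balls shrink to `1`**: every neighbourhood of `1` in `GL_n(F)` contains a
unipotent ball of non-zero radius. (Casselman 1995, Prop. 1.4.4.) [folklore] -/
theorem exists_unipotentBallGL_subset {U : Set (GL (Fin n) F)} (hU : U ∈ 𝓝 (1 : GL (Fin n) F)) :
    ∃ γ : (ValueGroupWithZero F)ˣ,
      (unipotentBallGL c (γ : ValueGroupWithZero F) : Set (GL (Fin n) F)) ⊆ U := by
  have hdir : Directed (· ⊇ ·) fun γ : (ValueGroupWithZero F)ˣ =>
      (unipotentBallGL c (γ : ValueGroupWithZero F) : Set (GL (Fin n) F)) := by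
    intro γ₁ γ₂
    rcases le_total γ₁ γ₂ with h | h
    · exact ⟨γ₁, subset_rfl, unipotentBallGL_mono (Units.val_le_val.2 h)⟩
    · exact ⟨γ₂, unipotentBallGL_mono (Units.val_le_val.2 h), subset_rfl⟩
  have hcpt : ∀ γ : (ValueGroupWithZero F)ˣ,
      IsCompact (unipotentBallGL c (γ : ValueGroupWithZero F) : Set (GL (Fin n) F)) :=
    fun γ => isCompact_unipotentBallGL _
  have hcl : ∀ γ : (ValueGroupWithZero F)ˣ,
      IsClosed (unipotentBallGL c (γ : ValueGroupWithZero F) : Set (GL (Fin n) F)) :=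
    fun γ => isClosed_unipotentBallGL _
  have hU' : ∀ x ∈ ⋂ γ : (ValueGroupWithZero F)ˣ,
      (unipotentBallGL c (γ : ValueGroupWithZero F) : Set (GL (Fin n) F)), U ∈ 𝓝 x := by
    intro x hx
    obtain rfl : x = 1 := eq_one_of_forall_mem_unipotentBallGL fun γ => Set.mem_iInter.1 hx γ
    exact hU
  exact exists_subset_nhds_of_isCompact' hdir hcpt hcl hU'

end TwoBlockTopology

/-! ### Matrices congruent to `1` modulo `𝓂` are invertible over `𝒪` -/

section NearOne

variable {F : Type*} [Field F] [ValuativeRel F] {m : Type*} [Fintype m] [DecidableEq m]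

/-- An integral matrix is the image of a matrix over `𝒪`. [folklore] -/
theorem exists_mapMatrix_eq_of_valBound_one {N : Matrix m m F} (h : ValBound 1 N) :
    ∃ N₀ : Matrix m m 𝒪[F], (𝒪[F]).subtype.mapMatrix N₀ = N :=
  ⟨Matrix.of fun i j => ⟨N i j, (Valuation.mem_integer_iff _ _).2 (h i j)⟩, by ext i j; rfl⟩

/-- The determinant of an integral matrix is integral. [folklore] -/
theorem valuation_det_le_one {N : Matrix m m F} (h : ValBound 1 N) : valuation F N.det ≤ 1 := by
  obtain ⟨N₀, rfl⟩ := exists_mapMatrix_eq_of_valBound_one h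
  rw [← RingHom.map_det]
  exact (Valuation.mem_integer_iff _ _).1 (N₀.det).2

/-- The adjugate of an integral matrix is integral. [folklore] -/
theorem valBound_one_adjugate {N : Matrix m m F} (h : ValBound 1 N) : ValBound 1 N.adjugate := by
  obtain ⟨N₀, rfl⟩ := exists_mapMatrix_eq_of_valBound_one h
  intro i j
  rw [← RingHom.map_adjugate, RingHom.mapMatrix_apply, Matrix.map_apply]
  exact (Valuation.mem_integer_iff _ _).1 (N₀.adjugate i j).2

/-- **A matrix congruent to `1` modulo `𝓂` has unit determinant**: if all entries of `M - 1`
have valuation `≤ γ < 1` then `|det M| = 1` (reduce modulo `𝓂`: `M̄ = 1`, so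
`det M ≡ 1 mod 𝓂`). [folklore] -/
theorem valuation_det_eq_one {M : Matrix m m F} {γ : ValueGroupWithZero F}
    (hM : ValBound γ (M - 1)) (hγ : γ < 1) : valuation F M.det = 1 := by
  obtain ⟨M₀, hM₀⟩ := exists_mapMatrix_eq_of_valBound_one (hM.of_sub_one hγ.le)
  -- the reduction of `M₀` is the identity matrix
  have hred : (IsLocalRing.residue 𝒪[F]).mapMatrix M₀ = 1 := by
    ext i j
    rw [RingHom.mapMatrix_apply, Matrix.map_apply]
    have h1 : (1 : Matrix m m 𝓀[F]) i j = IsLocalRing.residue 𝒪[F] ((1 : Matrix m m 𝒪[F]) i j) := by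
      rw [Matrix.one_apply, Matrix.one_apply]
      split_ifs <;> simp
    rw [h1, ← sub_eq_zero, ← map_sub]
    refine residue_eq_zero_of_valuation_lt_one (lt_of_le_of_lt ?_ hγ)
    have := hM i j
    rw [← hM₀, Matrix.sub_apply, RingHom.mapMatrix_apply, Matrix.map_apply] at this
    have h2 : ((M₀ i j - (1 : Matrix m m 𝒪[F]) i j : 𝒪[F]) : F) =
        (𝒪[F]).subtype (M₀ i j) - (1 : Matrix m m F) i j := by
      rw [AddSubgroupClass.coe_sub]
      congr 1
      rw [Matrix.one_apply, Matrix.one_apply]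
      split_ifs <;> simp
    rwa [h2]
  have hdet : IsLocalRing.residue 𝒪[F] (M₀.det - 1) = 0 := by
    rw [map_sub, RingHom.map_det, hred, Matrix.det_one, map_one, sub_self]
  have hlt : valuation F (M.det - 1) < 1 := by
    have := valuation_lt_one_of_residue_eq_zero hdet
    rwa [← hM₀, ← RingHom.map_det]
  rw [← (valuation F).map_one]
  refine Valuation.map_eq_of_sub_lt _ ?_
  rwa [Valuation.map_one]

/-- **Inverting a matrix congruent to `1` modulo `𝓂`**: if all entries of `M - 1` have
valuation `≤ γ < 1`, then `det M` is a unit, `M⁻¹` is integral and `M⁻¹ - 1 = M⁻¹ (1 - M)` again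
has all entries of valuation `≤ γ`. [folklore] -/
theorem isUnit_det_and_valBound_inv {M : Matrix m m F} {γ : ValueGroupWithZero F}
    (hM : ValBound γ (M - 1)) (hγ : γ < 1) :
    IsUnit M.det ∧ ValBound 1 M⁻¹ ∧ ValBound γ (M⁻¹ - 1) := by
  have hdet := valuation_det_eq_one hM hγ
  have hunit : IsUnit M.det := by
    rw [isUnit_iff_ne_zero]
    intro h0
    rw [h0, map_zero] at hdet
    exact zero_ne_one hdet
  have hinv : ValBound 1 M⁻¹ := by
    intro i j
    rw [Matrix.inv_def, Ring.inverse_eq_inv', Matrix.smul_apply, smul_eq_mul, map_mul, map_inv₀,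
      hdet, inv_one, one_mul]
    exact valBound_one_adjugate (hM.of_sub_one hγ.le) i j
  refine ⟨hunit, hinv, ?_⟩
  have : M⁻¹ - 1 = M⁻¹ * (-(M - 1)) := by
    rw [neg_sub, Matrix.mul_sub, Matrix.mul_one, Matrix.nonsing_inv_mul _ hunit]
  rw [this]
  simpa using hinv.mul hM.neg

end NearOne

/-! ### The opposite parabolic and the factorisation `K = (K ∩ U_c) (K ∩ P_c⁻)` -/

section Factorization

variable {F : Type*} [Field F] {n : ℕ}

/-- The **opposite standard parabolic** `P_c⁻` (block *lower* triangular matrices): the standard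
parabolic of the reversed labelling. (Bernstein–Zelevinsky 1977, §2.1.) [folklore] -/
abbrev oppositeParabolicGL (F : Type*) [Field F] {α : Type*} [LinearOrder α] (c : Fin n → α) :
    Subgroup (GL (Fin n) F) :=
  standardParabolicGL F (OrderDual.toDual ∘ c)

/-- Membership in the opposite parabolic: the entries strictly above the block diagonal vanish.
[folklore] -/
theorem mem_oppositeParabolicGL_iff {α : Type*} [LinearOrder α] {c : Fin n → α} (g : GL (Fin n) F) :
    g ∈ oppositeParabolicGL F c ↔ ∀ i j, c i < c j → (g : Matrix (Fin n) (Fin n) F) i j = 0 := by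
  rw [oppositeParabolicGL, mem_standardParabolicGL_iff]
  exact ⟨fun h i j hij => h hij, fun h i j hij => h i j hij⟩

variable [ValuativeRel F] {c : Fin n → Fin 2}

/-- In `Fin 2`, `x < y` forces `y = 1`. [folklore] -/
theorem fin_two_eq_one_of_lt {x y : Fin 2} (h : x < y) : y = 1 := by
  revert x y h; decide

/-- In `Fin 2`, `x < y` forces `x = 0`. [folklore] -/
theorem fin_two_eq_zero_of_lt {x y : Fin 2} (h : x < y) : x = 0 := by
  revert x y h; decide

/-- In `Fin 2`, `0 < 1`-type comparison from the values. [folklore] -/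
theorem fin_two_lt_of_eq {x y : Fin 2} (hx : x = 0) (hy : y = 1) : x < y := by
  subst hx hy; decide

omit [ValuativeRel F] in
/-- **Block elimination.** Let `k` be an `n × n` matrix whose lower-right block
`D = (k_{ab})_{c a = c b = 1}` has unit determinant, and let `X` be the matrix with entries
`X_{ij} = Σ_{c b = 1} k_{ib} (D⁻¹)_{bj}` for `c j = 1` (and `0` otherwise). Then the entries of
`(1 - X⁺) k` strictly above the block diagonal vanish: `B - B D⁻¹ D = 0`. [folklore] -/
theorem blockUpper_apply_one_sub_mul_eq_zero (k : Matrix (Fin n) (Fin n) F)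
    (hD : IsUnit (k.toSquareBlock c 1).det) {i j : Fin n} (hij : c i < c j) :
    ((1 - blockUpperPart c (Matrix.of fun i' j' => if h : c j' = 1 then
        ∑ b : {a // c a = 1}, k i' b * (k.toSquareBlock c 1)⁻¹ b ⟨j', h⟩ else 0)) * k) i j = 0 := by
  classical
  set D : Matrix {a // c a = 1} {a // c a = 1} F := k.toSquareBlock c 1 with hDdef
  set Y : Fin n → {a // c a = 1} → F := fun i' b' => ∑ b : {a // c a = 1}, k i' b * D⁻¹ b b'
    with hYdef
  have hj : c j = 1 := fin_two_eq_one_of_lt hij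
  have hi : c i = 0 := fin_two_eq_zero_of_lt hij
  rw [Matrix.sub_mul, Matrix.one_mul, Matrix.sub_apply, sub_eq_zero, Matrix.mul_apply]
  -- the sum over `l` only sees `c l = 1`
  have hterm : ∀ l : Fin n, blockUpperPart c (Matrix.of fun i' j' =>
      if h : c j' = 1 then Y i' ⟨j', h⟩ else 0) i l * k l j =
        if h : c l = 1 then Y i ⟨l, h⟩ * k l j else 0 := by
    intro l
    by_cases hl : c l = 1
    · rw [dif_pos hl, blockUpperPart_apply_of_lt _ (fin_two_lt_of_eq hi hl), Matrix.of_apply,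
        dif_pos hl]
    · rw [dif_neg hl, blockUpperPart_apply_of_le, zero_mul]
      have : c l = 0 := by
        rcases Fin.exists_fin_two.1 ⟨c l, rfl⟩ with h | h
        · exact h
        · exact absurd h hl
      rw [this, hi]
  symm
  calc ∑ l, blockUpperPart c (Matrix.of fun i' j' =>
        if h : c j' = 1 then Y i' ⟨j', h⟩ else 0) i l * k l j
      = ∑ l, (if h : c l = 1 then Y i ⟨l, h⟩ * k l j else 0) := Finset.sum_congr rfl fun l _ => hterm l
    _ = ∑ l ∈ Finset.univ.filter fun l => c l = 1, (if h : c l = 1 then Y i ⟨l, h⟩ * k l j else 0) := by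
        refine (Finset.sum_filter_of_ne fun l _ hl => ?_).symm
        by_contra h
        rw [dif_neg h] at hl
        exact hl rfl
    _ = ∑ b : {a // c a = 1}, (if h : c (b : Fin n) = 1 then Y i ⟨b, h⟩ * k b j else 0) :=
        Finset.sum_subtype _ (by simp) _
    _ = ∑ b : {a // c a = 1}, Y i b * D b ⟨j, hj⟩ := by
        refine Finset.sum_congr rfl fun b _ => ?_
        rw [dif_pos b.2]
        rfl
    _ = ∑ a : {a // c a = 1}, k i a * (D⁻¹ * D) a ⟨j, hj⟩ := by
        simp only [hYdef, Finset.sum_mul, Matrix.mul_apply, Finset.mul_sum, mul_assoc]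
        rw [Finset.sum_comm]
    _ = k i j := by
        rw [Matrix.nonsing_inv_mul _ hD]
        simp only [Matrix.one_apply, mul_ite, mul_one, mul_zero]
        rw [Finset.sum_ite_eq']
        simp

/-- **Iwahori-type factorisation of the principal congruence subgroups** with respect to a
two-block standard parabolic `P_c = M_c U_c` and its opposite `P_c⁻`: for `γ < 1`, every
`k ∈ K_γ = congruenceGL n γ` factors as `k = u p` with `u ∈ U_c ∩ K_γ` and `p ∈ P_c⁻ ∩ K_γ`.
Writing `k = (A B; C D)` in blocks, `D ≡ 1 mod 𝓂` is invertible over `𝒪` and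
`u = (1, B D⁻¹; 0, 1)`, `p = u⁻¹ k = (A - B D⁻¹ C, 0; C, D)`.
(Casselman 1995, Prop. 1.4.4; Bernstein–Zelevinsky 1976, §3.11.) [folklore] -/
theorem exists_unipotent_mul_opposite_of_mem_congruenceGL {γ : ValueGroupWithZero F} (hγ : γ < 1)
    {k : GL (Fin n) F} (hk : k ∈ congruenceGL n γ) :
    ∃ u ∈ unipotentRadicalGL F c, ∃ p ∈ oppositeParabolicGL F c,
      u ∈ congruenceGL n γ ∧ p ∈ congruenceGL n γ ∧ k = u * p := by
  classical
  set D : Matrix {a // c a = 1} {a // c a = 1} F := (k : Matrix (Fin n) (Fin n) F).toSquareBlock c 1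
    with hDdef
  -- `D ≡ 1` within `γ`
  have hD1 : ValBound γ (D - 1) := by
    rintro ⟨a, ha⟩ ⟨b, hb⟩
    have := hk.2.1 a b
    convert this using 2
    simp only [hDdef, Matrix.sub_apply, Matrix.toSquareBlock_def, Matrix.of_apply, Matrix.one_apply,
      Subtype.mk.injEq]
  obtain ⟨hDunit, hDinv, -⟩ := isUnit_det_and_valBound_inv hD1 hγ
  -- the matrix `X` with `X⁺ = (0, B D⁻¹; 0, 0)`
  set X : Matrix (Fin n) (Fin n) F := Matrix.of fun i' j' => if h : c j' = 1 then
      ∑ b : {a // c a = 1}, (k : Matrix (Fin n) (Fin n) F) i' b * D⁻¹ b ⟨j', h⟩ else 0 with hXdef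
  have hXbound : ValBound γ (blockUpperPart c X) := by
    intro i j
    by_cases hij : c i < c j
    · rw [blockUpperPart_apply_of_lt _ hij, hXdef, Matrix.of_apply, dif_pos (fin_two_eq_one_of_lt hij)]
      refine Valuation.map_sum_le _ fun b _ => ?_
      rw [map_mul]
      have hib : i ≠ (b : Fin n) := by
        rintro rfl
        rw [b.2] at hij
        exact absurd (fin_two_eq_zero_of_lt hij) (by decide)
      have h1 : valuation F ((k : Matrix (Fin n) (Fin n) F) i b) ≤ γ := by
        have := hk.2.1 i b
        rwa [Matrix.sub_apply, Matrix.one_apply_ne hib, sub_zero] at this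
      simpa using mul_le_mul' h1 (hDinv b _)
    · rw [blockUpperPart_apply_of_le _ (not_lt.1 hij), map_zero]
      exact zero_le
  set u : GL (Fin n) F := unipotentOfMatrix c X with hudef
  have hu_rad : u ∈ unipotentRadicalGL F c := by
    refine (mem_unipotentRadicalGL_iff_apply u).2 fun i j hij => ?_
    rw [hudef, coe_unipotentOfMatrix, Matrix.add_apply, blockUpperPart_apply_of_le _ hij, add_zero]
  have hu_cong : u ∈ congruenceGL n γ := by
    have hval : ValBound γ ((u : Matrix (Fin n) (Fin n) F) - 1) := by
      rw [hudef, coe_unipotentOfMatrix, add_sub_cancel_left]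
      exact hXbound
    have hinv : ValBound γ (((u⁻¹ : GL (Fin n) F) : Matrix (Fin n) (Fin n) F) - 1) := by
      rw [hudef, coe_unipotentOfMatrix_inv, sub_sub_cancel_left]
      exact hXbound.neg
    exact ⟨⟨hval.of_sub_one hγ.le, hinv.of_sub_one hγ.le⟩, hval, hinv⟩
  refine ⟨u, hu_rad, u⁻¹ * k, ?_, hu_cong, Subgroup.mul_mem _ (Subgroup.inv_mem _ hu_cong) hk,
    (mul_inv_cancel_left u k).symm⟩
  refine (mem_oppositeParabolicGL_iff _).2 fun i j hij => ?_
  rw [Units.val_mul, hudef, coe_unipotentOfMatrix_inv]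
  exact blockUpper_apply_one_sub_mul_eq_zero (k : Matrix (Fin n) (Fin n) F) hDunit hij

/-- **Conjugating the opposite parabolic part of a congruence subgroup by a dominant torus
element**: for `p ∈ P_c⁻ ∩ K_γ` and `a = (a_i)` with `a_i = N ≥ 0` on the block `c i = 0` and
`a_i = 0` on the block `c i = 1`, the conjugate `ϖ^{-a} p ϖ^{a}` again lies in `K_γ` (the
lower-left block is multiplied by `ϖ^N`, the diagonal blocks are unchanged).
(Casselman 1995, Prop. 1.4.3.) [folklore] -/
theorem conj_mem_congruenceGL_of_mem_opposite {ϖ : F} (hϖ : valuation F ϖ ≤ 1) (hϖ0 : ϖ ≠ 0)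
    (N : ℕ) {γ : ValueGroupWithZero F} {p : GL (Fin n) F} (hp : p ∈ oppositeParabolicGL F c)
    (hpK : p ∈ congruenceGL n γ) :
    (zpowDiagGL hϖ0 (fun i => if c i = 0 then (N : ℤ) else 0))⁻¹ * p *
        zpowDiagGL hϖ0 (fun i => if c i = 0 then (N : ℤ) else 0) ∈ congruenceGL n γ := by
  -- the scaling factor `ϖ^{a_j - a_i}` has valuation `≤ 1` unless `c i < c j`
  have hscale : ∀ i j : Fin n, ¬ c i < c j →
      valuation F (ϖ ^ ((if c j = 0 then (N : ℤ) else 0) - (if c i = 0 then (N : ℤ) else 0))) ≤ 1 := by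
    intro i j hij
    by_cases hi : c i = 0 <;> by_cases hj : c j = 0
    · simp [hi, hj]
    · exfalso; apply hij
      rcases Fin.exists_fin_two.1 ⟨c j, rfl⟩ with h | h
      · exact absurd h hj
      · exact fin_two_lt_of_eq hi h
    · simp only [hj, hi, if_true, if_false, sub_zero, zpow_natCast, map_pow]
      exact pow_le_one' hϖ N
    · simp [hi, hj]
  -- a generic estimate for `P⁻`-elements
  have key : ∀ {q : GL (Fin n) F}, q ∈ oppositeParabolicGL F c → ∀ {δ : ValueGroupWithZero F}
      {f : Matrix (Fin n) (Fin n) F → Matrix (Fin n) (Fin n) F},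
      (f = id ∨ f = fun M => M - 1) → ValBound δ (f (q : Matrix (Fin n) (Fin n) F)) →
      ValBound δ (f (((zpowDiagGL hϖ0 (fun i => if c i = 0 then (N : ℤ) else 0))⁻¹ * q *
        zpowDiagGL hϖ0 (fun i => if c i = 0 then (N : ℤ) else 0) : GL (Fin n) F) :
          Matrix (Fin n) (Fin n) F)) := by
    intro q hq δ f hf hb i j
    have hq0 := (mem_oppositeParabolicGL_iff q).1 hq
    rcases hf with rfl | rfl
    · rw [id, coe_zpowDiagGL_inv_mul_mul_apply, map_mul]
      by_cases hij : c i < c j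
      · rw [hq0 i j hij, map_zero, mul_zero]; exact zero_le
      · simpa using mul_le_mul' (hscale i j hij) (hb i j)
    · simp only
      rw [coe_zpowDiagGL_inv_mul_mul_sub_one_apply, map_mul]
      by_cases hij : c i < c j
      · have : ((q : Matrix (Fin n) (Fin n) F) - 1) i j = 0 := by
          rw [Matrix.sub_apply, hq0 i j hij, Matrix.one_apply_ne, sub_zero]
          rintro rfl; exact lt_irrefl _ hij
        rw [this, map_zero, mul_zero]; exact zero_le
      · simpa using mul_le_mul' (hscale i j hij) (hb i j)
  have hpinv : p⁻¹ ∈ oppositeParabolicGL F c := Subgroup.inv_mem _ hp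
  refine ⟨⟨key hp (Or.inl rfl) hpK.1.1, ?_⟩, key hp (Or.inr rfl) hpK.2.1, ?_⟩
  · have := key hpinv (Or.inl rfl) hpK.1.2
    simpa [_root_.mul_inv_rev, mul_assoc] using this
  · have := key hpinv (Or.inr rfl) hpK.2.2
    simpa [_root_.mul_inv_rev, mul_assoc] using this

end Factorization

end Literature.NumberTheory.Automorphic
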